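import Summits.CriticalPhenomena.SAWScalingLimit.Theses.SAWChargeContinuation
import Summits.CriticalPhenomena.SAWScalingLimit.Theorems.SAWLoopFugacityFlowAvoidanceDeterminesLaw
import Summits.CriticalPhenomena.SAWScalingLimit.Theorems.SAWLoopFugacityFlowSLEAvoidanceValue
import Summits.CriticalPhenomena.SAWScalingLimit.Theorems.SAWLoopFugacityFlowSLECarrier
import Literature.Probability.RandomPlanarGeometry.RestrictionHullsRiemannProofs
import Literature.Probability.RandomPlanarGeometry.RestrictionHullsProofs
import Literature.Probability.RandomPlanarGeometry.SLEExistenceNeEightHolds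

/-!
# `SAWChargeContinuation.RestrictionIdentification` (stmt-CriticalPhenomena-11197): LSW
identification of the SLE_{8/3} law from its hull-avoidance numbers

Route `SAWChargeContinuation` of `CriticalPhenomena/SAWScalingLimit`, support item
`RestrictionIdentification`: a probability law `μ` on `CurveClass ℂ` carried by the chordal
carrier of a Dobrushin domain `(D; a, b)` (simple classes from `a` to `b` with trace in
`D ∪ {a, b}`) whose mass of `{range ⊆ closure D'}` equals `d ^ (5/8)` for every hull subdomain
`D'`, every chordal uniformizing map `φ` of `D` and every restriction datum `(Φ, d = Φ_A'(0))` of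
the pulled-back hull `A = closure (ℍ ∖ φ⁻¹ D')`, IS the chordal SLE_{8/3} law of `D`.

## Proof (assembly of tree theorems)

Let `ν` be the chordal SLE_{8/3} law of `D` (`exists_isSLELaw_of_ne_eight`, Rohde–Schramm). It is
a probability law carried by the simple chords of `D` meeting `∂D` only at `a, b`
(`SLECarrier_proof`), and by [LSW] Thm. 6.1 transposed to hull subdomains
(`SLEAvoidanceValue_proof`, from `sle_restriction_eightThirds_holds`) it gives mass `d ^ (5/8)`
to `{range ⊆ closure D'}` for every subdomain `D' ⊆ D` with the same marked points agreeing with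
`D` near them, for any chordal uniformizing map `φ` (`MarkedDomain.exists_isChordalUniformizing_holds`)
and the restriction data of the `*`-hull `φ.pullbackHull D'` (`IsStarHull.pullbackHull`,
`IsStarHull.existsUnique_isRestrictionMap_holds`, `IsStarHull.exists_hasRestrictionDeriv_holds`).
The hypothesis on `μ` gives the same masses, so `μ = ν` by "avoidance determines the law"
(`AvoidanceDeterminesLaw_proof`, the curve-space form of [LSW] Lemma 3.2: the hull-subdomain
events generate the law of a simple chord). Hence `μ` is the SLE_{8/3} law of `D`.

References: G. F. Lawler, O. Schramm, W. Werner, *Conformal restriction: the chordal case*,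
J. Amer. Math. Soc. **16** (2003), Thm. 6.1 and Lemma 3.2; S. Rohde, O. Schramm, *Basic properties
of SLE*, Ann. of Math. **161** (2005), Thm. 5.1, 6.1.
-/

noncomputable section

open Set Filter Topology MeasureTheory
open UpperHalfPlane (upperHalfPlaneSet)
open Literature.Probability Literature.Probability.RandomPlanarGeometry
open scoped NNReal ENNReal

namespace Summit.CriticalPhenomena.SAWScalingLimit.Theorems

/-- A class of the chordal carrier of `(D; a, b)` (simple, from `a` to `b`, trace in
`D ∪ {a, b}`) is a simple chord of `D` with trace in `closure D` meeting `∂D` only inside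
`{a, b}` — the carrier clause of `AvoidanceDeterminesLaw`. [folklore] -/
theorem simple_chord_of_mem_chordalCarrier {D : DobrushinDomain} {γ : CurveClass ℂ}
    (hγ : γ ∈ chordalCarrier D) :
    γ ∈ CurveClass.simple ∧ γ.source = D.pt 0 ∧ γ.target = D.pt 1 ∧
      γ.range ⊆ closure D.carrier ∧ γ.range ∩ frontier D.carrier ⊆ {D.pt 0, D.pt 1} := by
  obtain ⟨⟨⟨hs, hsrc⟩, htgt⟩, hr⟩ := hγ
  refine ⟨hs, hsrc, htgt, subset_closure_of_subset_carrier_union hr, ?_⟩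
  rintro x ⟨hx, hxfr⟩
  rcases hr hx with hxD | hxab
  · exact absurd (by rwa [D.isOpen.interior_eq]) hxfr.2
  · exact hxab

/-- **`RestrictionIdentification` (stmt-CriticalPhenomena-11197) holds** — LSW identification from
avoidance numbers: a probability law `μ` on `CurveClass ℂ` carried by the chordal carrier of the
Dobrushin domain `D` whose masses of `{range ⊆ closure D'}` equal `d ^ (5/8)` for all hull
subdomains `D'` (with `d = Φ_A'(0)`, `A = φ.pullbackHull D'`, any chordal uniformizing `φ` and
restriction map `Φ`) is the chordal SLE_{8/3} law of `D`. Proof: the SLE_{8/3} law `ν` of `D`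
exists (Rohde–Schramm), is carried by simple chords (`SLECarrier_proof`) and has the same
avoidance numbers ([LSW] Thm. 6.1 transposed, `SLEAvoidanceValue_proof`); avoidance numbers over
hull subdomains determine the law of a simple chord (`AvoidanceDeterminesLaw_proof`, [LSW]
Lemma 3.2), so `μ = ν`. G. F. Lawler, O. Schramm, W. Werner, J. Amer. Math. Soc. 16 (2003),
Thm. 6.1, Lemma 3.2. -/
theorem RestrictionIdentification_proof :
    Summit.CriticalPhenomena.SAWScalingLimit.Theses.SAWChargeContinuation.RestrictionIdentification := by
  unfold Summit.CriticalPhenomena.SAWScalingLimit.Theses.SAWChargeContinuation.RestrictionIdentification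
  intro hull pb carrier D μ hμP hμcar hval
  -- the SLE_{8/3} law of `D` and its carrier
  obtain ⟨ν, hν⟩ := exists_isSLELaw_of_ne_eight (κ := (8 : ℝ≥0) / 3) (by positivity)
    eightThirds_ne_eight D
  have hcar := SLECarrier_proof
  unfold Summit.CriticalPhenomena.SAWScalingLimit.Theses.SAWLoopFugacityFlow.SLECarrier at hcar
  obtain ⟨hνP, hνcar⟩ := hcar D ν hν
  -- it suffices that `μ = ν`, by avoidance determines the law
  suffices hμν : μ = ν by rw [hμν]; exact hν
  have hADL := AvoidanceDeterminesLaw.AvoidanceDeterminesLaw_proof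
  unfold Summit.CriticalPhenomena.SAWScalingLimit.Theses.SAWLoopFugacityFlow.AvoidanceDeterminesLaw
    at hADL
  refine hADL D μ ν hμP hνP ?_ hνcar ?_
  · filter_upwards [hμcar] with γ hγ
    exact simple_chord_of_mem_chordalCarrier hγ
  · intro D' hsub h0 h1 hε
    -- `D'` is a hull subdomain; restriction data of its pulled-back `*`-hull
    have hD' : D.IsHullSubdomain D' :=
      IsingBoundaryRatio.Negative.isHullSubdomain_of_conds hsub h0 h1 hε
    obtain ⟨φ, hφ⟩ := MarkedDomain.exists_isChordalUniformizing_holds D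
    have hA : IsStarHull (φ.pullbackHull D') :=
      IsStarHull.pullbackHull JordanDomain.isSimplyConnected_holds hφ hD'
    obtain ⟨Φ, hΦ, -⟩ := IsStarHull.existsUnique_isRestrictionMap_holds hA
    obtain ⟨d, -, -, hd⟩ := IsStarHull.exists_hasRestrictionDeriv_holds hA hΦ
    -- both laws give mass `d ^ (5/8)` to `{range ⊆ closure D'}`
    have hSLE := SLEAvoidanceValue_proof
    unfold Summit.CriticalPhenomena.SAWScalingLimit.Theses.SAWLoopFugacityFlow.SLEAvoidanceValue
      at hSLE
    rw [hval D' hD' φ hφ Φ d hΦ hd,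
      hSLE D D' ν hν hsub h0 h1 hε φ hφ (φ.pullbackHull D') rfl Φ d hΦ hd]

end Summit.CriticalPhenomena.SAWScalingLimit.Theorems

end
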